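import Mathlib

/-!
# Route BarrierLever — Chow witnesses for partition minors (item 20172, CPM): determinant algebra of
# the GENERAL `k`-fold TENSOR BLOW-DOWN (star-like rows in `k` coordinates against `k` excess columns)

Helper file (`--supports stmt-ValiantsHypothesis-20172`; cell valiant-natproofs, rung V4, 𝒟-side of
door (c); seat val-np-p4 gen 14).  Closes NO item; pure matrix algebra, the `k`-fold generalisation of
the determinant core of the double step (`…ChowDoubleStepDet`: `det_doubleMasked_ne_zero`,
`det_doubleEdgeMatrix_eq`, `exists_det_doubleEdge_ne_zero`, `k = 2`; `k = 1` is the edge step), in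
the block (`Sum`) indexing of `…ChowMultiEdgeStepDet`: index type `Fin k ⊕ ρ`, the `k` SPECIAL rows
/ EXCESS columns are `Sum.inl _`, the common BASE row is `Sum.inr b₀`, the representative (base)
columns are `Sum.inr (βc e)`.

**The statement (`exists_det_multiTensor_ne_zero`).**  `F` square over `ℂ` on `Fin k ⊕ ρ`; for each
`l < k` a row predicate `P l` («`a_l ∈ u i`») and a column predicate `Q l` («`c_l ∈ w j`»); STAR-LIKE
rows: `P l'` fails on the base row `inr b₀` for every `l'`, holds on the special row `inl l` iff
`l' = l`, and every special row equals the base row in `F` (same `A`-erased label); EXCESS columns: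
`F i (inl e) = F i (inr (βc e))` (same `C`-erased label).  If the `k × k` STATUS-DIFFERENCE matrix
`Δ l e = [Q l (inl e)] − [Q l (inr (βc e))]` is nonsingular, the base-row entries `F (inr b₀) (inr (βc e))`
are nonzero and the reduced minor `F.submatrix inr inr` is nonsingular, then for some `t : ℂ` the
tensor-masked matrix `M(t) i j = t^{#{l : P l i ∧ Q l j}} · F i j` is nonsingular.  (With the tensor
gadget `∏_l (1 + x_{a_l} + (1 − t) y_{c_l})(1 + t y_{c_l})` times a `k`-fold lifted common witness the
partition matrix is exactly `M(t)` — memo HOME/val-np-p4/g13/MEMO-blowdown-steps-g13.md §2, identity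
`det M(t) = (t − 1)^k D(t)`, `D(1) = ± det Δ₀ · ∏_e F[label, ω_e] · det(reduced)`.)

Proof: as in `…ChowMultiEdgeStepDet` — subtracting the base row from each special row (a unipotent
block matrix) leaves `(t − 1)·[Q l j]·F (inr b₀) j`, so `det M(t) = (t − 1)^k det N(t)`; at `t = 1`,
subtracting representative columns from excess columns makes `N(1)` block upper-triangular with corner
`Δ · diagonal (F (inr b₀) (inr (βc e)))`; continuity of `t ↦ det N(t)`.

WHAT THIS IS NOT: the layout-level step (the `k`-fold coordinate lift + gadget + common witness) is
the consumer's job, as in `…ChowDoubleStep`; nothing on items 20172 / 20195 / 19717 themselves, on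
crux stmt-ValiantsHypothesis-14610, or on `VP` versus `VNP`.
-/

set_option linter.dupNamespace false

namespace Summit.ValiantsHypothesis.ValiantsHypothesis.Theorems.BarrierLever.ChowFactor

open Matrix

noncomputable section

variable {k : ℕ} {ρ : Type*} [Fintype ρ] [DecidableEq ρ]

/-- The tensor-masked matrix: `M(t) i j = t^{#{l : P l i ∧ Q l j}} · F i j`. -/
def multiTensorMatrix (F : Matrix (Fin k ⊕ ρ) (Fin k ⊕ ρ) ℂ) (P Q : Fin k → Fin k ⊕ ρ → Prop)
    [∀ l, DecidablePred (P l)] [∀ l, DecidablePred (Q l)] (t : ℂ) : Matrix (Fin k ⊕ ρ) (Fin k ⊕ ρ) ℂ :=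
  Matrix.of fun i j => (∏ l, if P l i ∧ Q l j then t else 1) * F i j

/-- The auxiliary matrix `N(t)`: special rows replaced by the `Q l`-masked base row, the other rows
those of `M(t)`. -/
def multiTensorAux (F : Matrix (Fin k ⊕ ρ) (Fin k ⊕ ρ) ℂ) (P Q : Fin k → Fin k ⊕ ρ → Prop)
    [∀ l, DecidablePred (P l)] [∀ l, DecidablePred (Q l)] (b₀ : ρ) (t : ℂ) :
    Matrix (Fin k ⊕ ρ) (Fin k ⊕ ρ) ℂ :=
  Matrix.of fun i j => match i with
    | Sum.inl l => (if Q l j then (1 : ℂ) else 0) * F (Sum.inr b₀) j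
    | Sum.inr m => (∏ l, if P l (Sum.inr m) ∧ Q l j then t else 1) * F (Sum.inr m) j

omit [Fintype ρ] [DecidableEq ρ] in
/-- The mask of a special row `inl l` is `t^{[Q l j]}` when `P l'` holds on it exactly for `l' = l`. -/
theorem prod_mask_special (P Q : Fin k → Fin k ⊕ ρ → Prop) [∀ l, DecidablePred (P l)]
    [∀ l, DecidablePred (Q l)] (hP : ∀ l l', P l' (Sum.inl l) ↔ l' = l) (t : ℂ) (l : Fin k)
    (j : Fin k ⊕ ρ) :
    (∏ l', if P l' (Sum.inl l) ∧ Q l' j then t else 1) = if Q l j then t else 1 := by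
  classical
  rw [Finset.prod_eq_single l]
  · simp [hP l l]
  · intro l' _ hl'
    have : ¬ P l' (Sum.inl l) := fun h => hl' ((hP l l').mp h)
    simp [this]
  · intro h; exact absurd (Finset.mem_univ l) h

/-- **Row reduction**: `det M(t) = (t − 1)^k · det N(t)`. -/
theorem det_multiTensorMatrix_eq (F : Matrix (Fin k ⊕ ρ) (Fin k ⊕ ρ) ℂ)
    (P Q : Fin k → Fin k ⊕ ρ → Prop) [∀ l, DecidablePred (P l)] [∀ l, DecidablePred (Q l)] (b₀ : ρ)
    (hP : ∀ l l', P l' (Sum.inl l) ↔ l' = l) (hP0 : ∀ l', ¬ P l' (Sum.inr b₀))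
    (hrow : ∀ l j, F (Sum.inl l) j = F (Sum.inr b₀) j) (t : ℂ) :
    (multiTensorMatrix F P Q t).det = (t - 1) ^ k * (multiTensorAux F P Q b₀ t).det := by
  classical
  set E : Matrix (Fin k ⊕ ρ) (Fin k ⊕ ρ) ℂ :=
    Matrix.fromBlocks 1 (Matrix.of fun (_ : Fin k) m => if m = b₀ then (-1 : ℂ) else 0) 0 1 with hE
  have hEdet : E.det = 1 := by
    rw [hE, Matrix.det_fromBlocks_zero₂₁, Matrix.det_one, Matrix.det_one, mul_one]
  set Δ : Matrix (Fin k ⊕ ρ) (Fin k ⊕ ρ) ℂ := Matrix.diagonal (Sum.elim (fun _ => t - 1) (fun _ => 1))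
    with hΔ
  have hΔdet : Δ.det = (t - 1) ^ k := by
    rw [hΔ, Matrix.det_diagonal, Fintype.prod_sum_type]
    simp
  have hEM_inl : ∀ l j, (E * multiTensorMatrix F P Q t) (Sum.inl l) j =
      multiTensorMatrix F P Q t (Sum.inl l) j - multiTensorMatrix F P Q t (Sum.inr b₀) j := by
    intro l j
    rw [Matrix.mul_apply, Fintype.sum_sum_type]
    simp [hE, Matrix.one_apply, ite_mul, Finset.sum_ite_eq, sub_eq_add_neg]
  have hEM_inr : ∀ m j, (E * multiTensorMatrix F P Q t) (Sum.inr m) j = multiTensorMatrix F P Q t (Sum.inr m) j := by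
    intro m j
    rw [Matrix.mul_apply, Fintype.sum_sum_type]
    simp [hE, Matrix.one_apply, ite_mul, Finset.sum_ite_eq]
  have hΔN : ∀ i j, (Δ * multiTensorAux F P Q b₀ t) i j =
      Sum.elim (fun _ => t - 1) (fun _ => (1 : ℂ)) i * multiTensorAux F P Q b₀ t i j := by
    intro i j
    rw [hΔ, Matrix.diagonal_mul]
  have hbase : ∀ j, (∏ l', if P l' (Sum.inr b₀) ∧ Q l' j then t else 1) = (1 : ℂ) := by
    intro j
    exact Finset.prod_eq_one fun l' _ => by simp [hP0 l']
  have key : E * multiTensorMatrix F P Q t = Δ * multiTensorAux F P Q b₀ t := by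
    ext i j
    rcases i with l | m
    · rw [hEM_inl, hΔN, Sum.elim_inl]
      simp only [multiTensorMatrix, multiTensorAux, Matrix.of_apply, hrow l j, prod_mask_special P Q hP,
        hbase, one_mul]
      split_ifs <;> ring
    · rw [hEM_inr, hΔN, Sum.elim_inr, one_mul]
      simp only [multiTensorMatrix, multiTensorAux, Matrix.of_apply]
  have h1 := congrArg Matrix.det key
  rw [Matrix.det_mul, Matrix.det_mul, hEdet, one_mul, hΔdet] at h1
  exact h1

/-- **Column reduction at `t = 1`**:
`det N(1) = det (Δ · diagonal (F (inr b₀) (inr (βc e)))) · det (F.submatrix inr inr)` with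
`Δ l e = [Q l (inl e)] − [Q l (inr (βc e))]`. -/
theorem det_multiTensorAux_one (F : Matrix (Fin k ⊕ ρ) (Fin k ⊕ ρ) ℂ)
    (P Q : Fin k → Fin k ⊕ ρ → Prop) [∀ l, DecidablePred (P l)] [∀ l, DecidablePred (Q l)] (b₀ : ρ)
    (βc : Fin k → ρ) (hcol : ∀ i e, F i (Sum.inl e) = F i (Sum.inr (βc e))) :
    (multiTensorAux F P Q b₀ 1).det =
      ((Matrix.of fun l e : Fin k =>
          (if Q l (Sum.inl e) then (1 : ℂ) else 0) - (if Q l (Sum.inr (βc e)) then 1 else 0)) *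
        Matrix.diagonal (fun e => F (Sum.inr b₀) (Sum.inr (βc e)))).det *
        (F.submatrix Sum.inr Sum.inr).det := by
  classical
  set H : Matrix (Fin k ⊕ ρ) (Fin k ⊕ ρ) ℂ :=
    Matrix.fromBlocks 1 0 (Matrix.of fun m e => if m = βc e then (-1 : ℂ) else 0) 1 with hH
  have hHdet : H.det = 1 := by
    rw [hH, Matrix.det_fromBlocks_zero₁₂, Matrix.det_one, Matrix.det_one, mul_one]
  have hNH_inl : ∀ i e, (multiTensorAux F P Q b₀ 1 * H) i (Sum.inl e) =
      multiTensorAux F P Q b₀ 1 i (Sum.inl e) - multiTensorAux F P Q b₀ 1 i (Sum.inr (βc e)) := by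
    intro i e
    rw [Matrix.mul_apply, Fintype.sum_sum_type]
    simp [hH, Matrix.one_apply, mul_ite, Finset.sum_ite_eq', sub_eq_add_neg]
  have hNH_inr : ∀ i m, (multiTensorAux F P Q b₀ 1 * H) i (Sum.inr m) = multiTensorAux F P Q b₀ 1 i (Sum.inr m) := by
    intro i m
    rw [Matrix.mul_apply, Fintype.sum_sum_type]
    simp [hH, Matrix.one_apply, mul_ite, Finset.sum_ite_eq']
  have hone : ∀ (i j : Fin k ⊕ ρ), (∏ l, if P l i ∧ Q l j then (1 : ℂ) else 1) = 1 := fun i j =>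
    Finset.prod_eq_one fun l _ => by split_ifs <;> rfl
  have key : multiTensorAux F P Q b₀ 1 * H = Matrix.fromBlocks
      ((Matrix.of fun l e : Fin k =>
          (if Q l (Sum.inl e) then (1 : ℂ) else 0) - (if Q l (Sum.inr (βc e)) then 1 else 0)) *
        Matrix.diagonal (fun e => F (Sum.inr b₀) (Sum.inr (βc e))))
      (Matrix.of fun l m => (if Q l (Sum.inr m) then (1 : ℂ) else 0) * F (Sum.inr b₀) (Sum.inr m))
      0 (F.submatrix Sum.inr Sum.inr) := by
    ext i j
    rcases i with l | m <;> rcases j with e | m'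
    · rw [hNH_inl, Matrix.fromBlocks_apply₁₁, Matrix.mul_diagonal]
      simp only [multiTensorAux, Matrix.of_apply, hcol]
      ring
    · rw [hNH_inr, Matrix.fromBlocks_apply₁₂]
      simp only [multiTensorAux, Matrix.of_apply]
    · rw [hNH_inl, Matrix.fromBlocks_apply₂₁, Matrix.zero_apply]
      simp only [multiTensorAux, Matrix.of_apply, hone, one_mul, hcol, sub_self]
    · rw [hNH_inr, Matrix.fromBlocks_apply₂₂, Matrix.submatrix_apply]
      simp only [multiTensorAux, Matrix.of_apply, hone, one_mul]
  have h1 := congrArg Matrix.det key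
  rw [Matrix.det_mul, hHdet, mul_one, Matrix.det_fromBlocks_zero₂₁] at h1
  exact h1

/-- **The `k`-fold tensor blow-down, determinant form.**  Under the hypotheses of the module
docstring some `t : ℂ` makes the tensor-masked matrix `M(t)` nonsingular. -/
theorem exists_det_multiTensor_ne_zero (F : Matrix (Fin k ⊕ ρ) (Fin k ⊕ ρ) ℂ)
    (P Q : Fin k → Fin k ⊕ ρ → Prop) [∀ l, DecidablePred (P l)] [∀ l, DecidablePred (Q l)] (b₀ : ρ)
    (βc : Fin k → ρ) (hP : ∀ l l', P l' (Sum.inl l) ↔ l' = l) (hP0 : ∀ l', ¬ P l' (Sum.inr b₀))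
    (hrow : ∀ l j, F (Sum.inl l) j = F (Sum.inr b₀) j)
    (hcol : ∀ i e, F i (Sum.inl e) = F i (Sum.inr (βc e)))
    (hΔ : (Matrix.of fun l e : Fin k =>
      (if Q l (Sum.inl e) then (1 : ℂ) else 0) - (if Q l (Sum.inr (βc e)) then 1 else 0)).det ≠ 0)
    (hlab : ∀ e, F (Sum.inr b₀) (Sum.inr (βc e)) ≠ 0)
    (hred : (F.submatrix Sum.inr Sum.inr).det ≠ 0) :
    ∃ t : ℂ, (multiTensorMatrix F P Q t).det ≠ 0 := by
  classical
  set D : ℂ → ℂ := fun t => (multiTensorAux F P Q b₀ t).det with hD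
  have hD1 : D 1 ≠ 0 := by
    show (multiTensorAux F P Q b₀ 1).det ≠ 0
    rw [det_multiTensorAux_one F P Q b₀ βc hcol, Matrix.det_mul, Matrix.det_diagonal]
    exact mul_ne_zero (mul_ne_zero hΔ (Finset.prod_ne_zero_iff.mpr fun e _ => hlab e)) hred
  have hcont : Continuous D := by
    refine Continuous.matrix_det ?_
    refine continuous_pi fun i => continuous_pi fun j => ?_
    rcases i with l | m
    · simp only [multiTensorAux, Matrix.of_apply]
      exact continuous_const
    · simp only [multiTensorAux, Matrix.of_apply]
      refine Continuous.mul (continuous_finsetProd _ fun l _ => ?_) continuous_const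
      split_ifs
      · exact continuous_id
      · exact continuous_const
  have hopen : IsOpen {t : ℂ | D t ≠ 0} := isOpen_ne_fun hcont continuous_const
  obtain ⟨ε, hε, hball⟩ := Metric.isOpen_iff.mp hopen 1 hD1
  refine ⟨1 + ε / 2, ?_⟩
  have hmem : (1 + (ε / 2 : ℂ)) ∈ Metric.ball (1 : ℂ) ε := by
    rw [Metric.mem_ball, dist_eq_norm]
    have : (1 + (ε / 2 : ℂ)) - 1 = ((ε / 2 : ℝ) : ℂ) := by push_cast; ring
    rw [this, Complex.norm_real, Real.norm_eq_abs, abs_of_pos (by positivity)]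
    linarith
  have hDt : D (1 + ε / 2) ≠ 0 := hball hmem
  have hne : (1 + (ε / 2 : ℂ)) - 1 ≠ 0 := by
    have : (1 + (ε / 2 : ℂ)) - 1 = ((ε / 2 : ℝ) : ℂ) := by push_cast; ring
    rw [this, Complex.ofReal_ne_zero]
    positivity
  rw [det_multiTensorMatrix_eq F P Q b₀ hP hP0 hrow]
  exact mul_ne_zero (pow_ne_zero _ hne) hDt

end

end Summit.ValiantsHypothesis.ValiantsHypothesis.Theorems.BarrierLever.ChowFactor
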